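import Literature.Analysis.FluidPDE.PineauVicolPressureDecayClass
import Literature.Analysis.FluidPDE.SpaceTimeCalculus

/-!
# Crux `ScarRigidity` (stmt-NavierStokesRegularity-11717), line `moment-conditioned-rellich`:
# stub `stub_apexRegularity` — IV: parametric integrals in TIME (tools for the time regularity of the Riesz pressure)

Helper file (`--supports stmt-NavierStokesRegularity-11717`; theorems only, no definitions, no named
facts) for the registered stub `stub_apexRegularity` of line `moment-conditioned-rellich` (crux `ScarRigidity`,
route RellichScar): a Type-I ancient mild field `V` with the apex bound `‖V(t,x)‖ ≤ C/(‖x‖+√(−t))` is a classical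
Navier–Stokes solution on `(−∞, 0)` with a pressure `Q` obeying the ALL-ORDERS scale-invariant package
`‖∇ⁿV‖ ≤ L/(‖x‖+√(−t))^{1+n}`, `‖∇ⁿQ‖ ≤ L/(‖x‖+√(−t))^{2+n}`, `‖∂ₜ∇ⁿV‖ ≤ L/(‖x‖+√(−t))^{3+n}`; necessarily `Q` is
the Riesz pressure `Q[V(t)] = RᵢRⱼ(VᵢVⱼ)` (the tree's `pressurePotential`).  The velocity and the
(spatial) pressure bounds being scale-invariant, the one genuinely new point of the stub is the JOINT smoothness of
the Riesz pressure in `(t, x)`, i.e. the time regularity of `t ↦ Q[V(t)](0)`: a bootstrap through the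
differentiated momentum equation in which every time derivative of `V` must be shown to decay at spatial infinity.
This file provides the abstract tools of that bootstrap:

* `family_contDiffOn_and_bound` — families `f b c` of functions on an open set, continuous and bounded by `B` for
  `b + c ≤ A` and with `(f b c)' = f (b+1) c + f b (c+1)` for `b + c + 1 ≤ A`, are `Cʲ` with `‖∂ʲf b c‖ ≤ 2ʲB`
  (`b + c + j ≤ A`) — the shape of every Leibniz rule for a bilinear expression in a time-differentiated field;
* `continuousOn_/hasDerivAt_integral_smul_comp_sub_time` — continuity and differentiation in time under
  `∫ k(z) • h(t, y − z) dz` for a compactly supported `L¹` kernel and jointly continuous `h`, `∂ₜh`;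
* `weight_kernel_le`, `norm_far_integral_le` — the convolution of `(1+|·|)⁻³` with `(1+|·|)⁻²` decays like
  `(1+|y|)⁻¹` (pointwise: `(1+|y|)(1+|y−η|)⁻³(1+|η|)⁻² ≤ 2((1+|y−η|)⁻⁴ + (1+|η|)⁻⁴)`), and
  `continuousOn_/hasDerivAt_far_integral` — continuity and differentiation in time of the far bilinear integral
  `∫ K(y − η)(u(t,η), w(t,η)) dη` for a kernel `‖K z‖ ≤ M/(1+|z|)³` and fields decaying like `(1+|η|)⁻¹`.

## References

* G. Koch, N. Nadirashvili, G. Seregin, V. Šverák, Acta Math. 203 (2009) 83–105 = arXiv:0709.3599, §4 Prop. 4.1,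
  §6. [KochNadirashviliSereginSverak2009]
* G. Seregin, V. Šverák, Comm. PDE 34 (2009) = arXiv:0804.1803, §2 p. 8. [SereginSverak2009]
* B. Pineau, V. Vicol, arXiv:2607.09619 (2026), Lemma 2.1, Lemma 7.1. [PineauVicol2026]
* D. Gilbarg, N. S. Trudinger, *Elliptic PDE of Second Order* (2001), Lemma 4.1–4.2. [GilbargTrudinger2001]
-/

noncomputable section

open MeasureTheory Set Function Filter Topology Metric
open scoped ContDiff Laplacian

-- nested operator types (`ℝ³ →L[ℝ] ℝ³ →L[ℝ] ℝ³ →L[ℝ] ℝ`, `(X →L[ℝ] X [×n]→L[ℝ] F) →L[ℝ] X [×(n+1)]→L[ℝ] F`)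
set_option maxSynthPendingDepth 4

namespace Summit.NavierStokesRegularity.NavierStokesRegularity.Theorems.RellichScarScarRigidity

open Literature.Analysis.FluidPDE
open Literature.Analysis.FluidPDE.FourierNS (HasDecay)

/-! ### An abstract bootstrap: families closed under differentiation -/

/-- **Families closed under differentiation are smooth, with geometric bounds.**  Let `f b c` (`b, c ∈ ℕ`)
be functions on an open set `W` (values in a normed space) such that, for `b + c ≤ A`, `f b c` is continuous on `W` and bounded by
`B` there, and, for `b + c + 1 ≤ A`, `(f b c)' = f (b+1) c + f b (c+1)` on `W`.  Then for `b + c + j ≤ A` the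
function `f b c` is `Cʲ` on `W` with `|∂ʲ f b c| ≤ 2ʲ B` (the shape of every Leibniz rule for a bilinear
expression in a time-differentiated field). [folklore] -/
theorem family_contDiffOn_and_bound {G : Type*} [NormedAddCommGroup G] [NormedSpace ℝ G] {W : Set ℝ}
    (hW : IsOpen W) {f : ℕ → ℕ → ℝ → G} {A : ℕ} {B : ℝ}
    (hcont : ∀ b c, b + c ≤ A → ContinuousOn (f b c) W)
    (hbound : ∀ b c, b + c ≤ A → ∀ t ∈ W, ‖f b c t‖ ≤ B)
    (hderiv : ∀ b c, b + c + 1 ≤ A → ∀ t ∈ W, HasDerivAt (f b c) (f (b + 1) c t + f b (c + 1) t) t) :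
    ∀ (j b c : ℕ), b + c + j ≤ A →
      ContDiffOn ℝ j (f b c) W ∧ ∀ t ∈ W, ‖iteratedDerivWithin j (f b c) W t‖ ≤ 2 ^ j * B := by
  have hU : UniqueDiffOn ℝ W := hW.uniqueDiffOn
  intro j
  induction j with
  | zero =>
    intro b c hbc
    refine ⟨contDiffOn_zero.2 (hcont b c (by omega)), fun t ht => ?_⟩
    rw [iteratedDerivWithin_zero, pow_zero, one_mul]
    exact hbound b c (by omega) t ht
  | succ j ih =>
    intro b c hbc
    have hd : ∀ t ∈ W, HasDerivAt (f b c) (f (b + 1) c t + f b (c + 1) t) t := hderiv b c (by omega)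
    have hdiff : DifferentiableOn ℝ (f b c) W := fun t ht => (hd t ht).differentiableAt.differentiableWithinAt
    have heq : EqOn (derivWithin (f b c) W) (f (b + 1) c + f b (c + 1)) W := fun t ht => by
      rw [derivWithin_of_isOpen hW ht, (hd t ht).deriv]
      rfl
    obtain ⟨h1c, h1b⟩ := ih (b + 1) c (by omega)
    obtain ⟨h2c, h2b⟩ := ih b (c + 1) (by omega)
    have hsum : ContDiffOn ℝ j (f (b + 1) c + f b (c + 1)) W := h1c.add h2c
    refine ⟨?_, fun t ht => ?_⟩
    · rw [show ((j + 1 : ℕ) : WithTop ℕ∞) = (j : WithTop ℕ∞) + 1 by push_cast; rfl,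
        contDiffOn_succ_iff_derivWithin hU]
      exact ⟨hdiff, fun h => absurd h (by exact_mod_cast WithTop.natCast_ne_top j), hsum.congr heq⟩
    · rw [iteratedDerivWithin_succ', iteratedDerivWithin_congr heq ht,
        iteratedDerivWithin_add ht hU (h1c t ht) (h2c t ht), pow_succ]
      have := h1b t ht
      have := h2b t ht
      calc ‖iteratedDerivWithin j (f (b + 1) c) W t + iteratedDerivWithin j (f b (c + 1)) W t‖
          ≤ ‖iteratedDerivWithin j (f (b + 1) c) W t‖ + ‖iteratedDerivWithin j (f b (c + 1)) W t‖ := norm_add_le _ _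
        _ ≤ 2 ^ j * B + 2 ^ j * B := add_le_add (h1b t ht) (h2b t ht)
        _ = 2 ^ j * 2 * B := by ring

/-! ### Parametric integrals in time, I: compactly supported `L¹` kernels -/

section Slices

variable {G : Type*} [NormedAddCommGroup G]
variable {W : Set ℝ}

/-- A jointly continuous field is bounded on `[t − δ, t + δ] × B̄(y, R)`. [folklore] -/
theorem exists_bound_near {h : ℝ → EuclideanSpace ℝ (Fin 3) → G} (hh : ContinuousOn (uncurry h) (W ×ˢ univ))
    {t δ : ℝ} (hδ : Icc (t - δ) (t + δ) ⊆ W) (y : EuclideanSpace ℝ (Fin 3)) (R : ℝ) :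
    ∃ C, ∀ s ∈ Icc (t - δ) (t + δ), ∀ z : EuclideanSpace ℝ (Fin 3), ‖z‖ ≤ R → ‖h s (y - z)‖ ≤ C := by
  have hK : IsCompact (Icc (t - δ) (t + δ) ×ˢ closedBall y R) := isCompact_Icc.prod (isCompact_closedBall y R)
  have hc : ContinuousOn (uncurry h) (Icc (t - δ) (t + δ) ×ˢ closedBall y R) :=
    hh.mono (prod_mono hδ (subset_univ _))
  obtain ⟨C, hC⟩ := hK.exists_bound_of_continuousOn hc
  refine ⟨C, fun s hs z hz => ?_⟩
  have hm : (s, y - z) ∈ Icc (t - δ) (t + δ) ×ˢ closedBall y R :=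
    ⟨hs, mem_closedBall_iff_norm.2 (by rw [sub_sub_cancel_left, norm_neg]; exact hz)⟩
  exact hC (s, y - z) hm

/-- Slices of a jointly continuous field are continuous. [folklore] -/
theorem continuous_slice_of_continuousOn_prod {h : ℝ → EuclideanSpace ℝ (Fin 3) → G}
    (hh : ContinuousOn (uncurry h) (W ×ˢ univ)) {s : ℝ} (hs : s ∈ W) : Continuous (h s) := by
  have hc : Continuous fun x : EuclideanSpace ℝ (Fin 3) => ((s, x) : ℝ × EuclideanSpace ℝ (Fin 3)) :=
    continuous_const.prodMk continuous_id
  exact hh.comp_continuous hc fun x => mk_mem_prod hs (mem_univ x)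

/-- Time lines of a jointly continuous field are continuous on the time set. [folklore] -/
theorem continuousOn_timeLine_of_continuousOn_prod {h : ℝ → EuclideanSpace ℝ (Fin 3) → G}
    (hh : ContinuousOn (uncurry h) (W ×ˢ univ)) (x : EuclideanSpace ℝ (Fin 3)) :
    ContinuousOn (fun s => h s x) W := by
  have hc : Continuous fun s : ℝ => ((s, x) : ℝ × EuclideanSpace ℝ (Fin 3)) :=
    continuous_id.prodMk continuous_const
  exact hh.comp hc.continuousOn fun s hs => mk_mem_prod hs (mem_univ x)

end Slices

section Near

variable {G : Type*} [NormedAddCommGroup G] [NormedSpace ℝ G]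
variable {W : Set ℝ} {k : EuclideanSpace ℝ (Fin 3) → ℝ} {ρ : ℝ}

/-- **Continuity in time of `t ↦ ∫ k(z) • h(t, y − z) dz`** for `k ∈ L¹` vanishing off a ball and `h` jointly
continuous on `W × ℝ³`, `W` open. [folklore] -/
theorem continuousOn_integral_smul_comp_sub_time (hW : IsOpen W) (hk : Integrable k)
    (hkρ : ∀ z, ρ < ‖z‖ → k z = 0) {h : ℝ → EuclideanSpace ℝ (Fin 3) → G}
    (hh : ContinuousOn (uncurry h) (W ×ˢ univ)) (y : EuclideanSpace ℝ (Fin 3)) :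
    ContinuousOn (fun t => ∫ z, k z • h t (y - z)) W := by
  intro t ht
  obtain ⟨δ, hδ0, hδW⟩ := Metric.isOpen_iff.1 hW t ht
  have hIcc : Icc (t - δ / 2) (t + δ / 2) ⊆ W := fun s hs => hδW (by
    rw [mem_ball, Real.dist_eq, abs_lt]; constructor <;> linarith [hs.1, hs.2])
  obtain ⟨C, hC⟩ := exists_bound_near hh hIcc y ρ
  have hball : ball t (δ / 2) ⊆ Icc (t - δ / 2) (t + δ / 2) := fun s hs => by
    rw [mem_ball, Real.dist_eq, abs_lt] at hs; constructor <;> linarith [hs.1, hs.2]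
  have hmeas : ∀ s ∈ W, AEStronglyMeasurable (fun z => k z • h s (y - z)) volume := fun s hs =>
    hk.aestronglyMeasurable.smul
      ((continuous_slice_of_continuousOn_prod hh hs).comp (continuous_const.sub continuous_id)).aestronglyMeasurable
  refine (continuousAt_of_dominated (bound := fun z => ‖k z‖ * C) ?_ ?_ (hk.norm.mul_const C) ?_).continuousWithinAt
  · filter_upwards [hW.mem_nhds ht] with s hs using hmeas s hs
  · filter_upwards [ball_mem_nhds t (half_pos hδ0)] with s hs
    refine Eventually.of_forall fun z => ?_
    by_cases hz : ‖z‖ ≤ ρ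
    · rw [norm_smul]
      exact mul_le_mul_of_nonneg_left (hC s (hball hs) z hz) (norm_nonneg _)
    · rw [hkρ z (not_le.1 hz), zero_smul, norm_zero, norm_zero, zero_mul]
  · refine Eventually.of_forall fun z => ?_
    exact ((continuousOn_timeLine_of_continuousOn_prod hh (y - z)).continuousAt (hW.mem_nhds ht)).const_smul _

/-- **Differentiation in time under `∫ k(z) • h(t, y − z) dz`** for `k ∈ L¹` vanishing off a ball: if `h` and
`h₁` are jointly continuous on `W × ℝ³` (`W` open) and `∂ₜh(t, x) = h₁(t, x)` for `t ∈ W`, then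
`∂ₜ ∫ k(z) • h(t, y − z) dz = ∫ k(z) • h₁(t, y − z) dz`. [folklore] -/
theorem hasDerivAt_integral_smul_comp_sub_time (hW : IsOpen W) (hk : Integrable k)
    (hkρ : ∀ z, ρ < ‖z‖ → k z = 0) {h h₁ : ℝ → EuclideanSpace ℝ (Fin 3) → G}
    (hh : ContinuousOn (uncurry h) (W ×ˢ univ)) (hh₁ : ContinuousOn (uncurry h₁) (W ×ˢ univ))
    (hd : ∀ t ∈ W, ∀ x, HasDerivAt (fun s => h s x) (h₁ t x) t) (y : EuclideanSpace ℝ (Fin 3))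
    {t : ℝ} (ht : t ∈ W) :
    HasDerivAt (fun s => ∫ z, k z • h s (y - z)) (∫ z, k z • h₁ t (y - z)) t := by
  obtain ⟨δ, hδ0, hδW⟩ := Metric.isOpen_iff.1 hW t ht
  have hIcc : Icc (t - δ / 2) (t + δ / 2) ⊆ W := fun s hs => hδW (by
    rw [mem_ball, Real.dist_eq, abs_lt]; constructor <;> linarith [hs.1, hs.2])
  obtain ⟨C, hC⟩ := exists_bound_near hh₁ hIcc y ρ
  have hball : ball t (δ / 2) ⊆ Icc (t - δ / 2) (t + δ / 2) := fun s hs => by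
    rw [mem_ball, Real.dist_eq, abs_lt] at hs; constructor <;> linarith [hs.1, hs.2]
  have hballW : ball t (δ / 2) ⊆ W := (hball.trans hIcc)
  have hmeas : ∀ s ∈ W, AEStronglyMeasurable (fun z => k z • h s (y - z)) volume := fun s hs =>
    hk.aestronglyMeasurable.smul
      ((continuous_slice_of_continuousOn_prod hh hs).comp (continuous_const.sub continuous_id)).aestronglyMeasurable
  refine (hasDerivAt_integral_of_dominated_loc_of_deriv_le (F' := fun s z => k z • h₁ s (y - z))
    (bound := fun z => ‖k z‖ * C) (ball_mem_nhds t (half_pos hδ0)) ?_ ?_ ?_ ?_ (hk.norm.mul_const C) ?_).2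
  · filter_upwards [hW.mem_nhds ht] with s hs using hmeas s hs
  · exact integrable_smul_comp_sub hk hkρ (continuous_slice_of_continuousOn_prod hh ht) y
  · exact hk.aestronglyMeasurable.smul
      ((continuous_slice_of_continuousOn_prod hh₁ ht).comp (continuous_const.sub continuous_id)).aestronglyMeasurable
  · refine Eventually.of_forall fun z s hs => ?_
    by_cases hz : ‖z‖ ≤ ρ
    · rw [norm_smul]
      exact mul_le_mul_of_nonneg_left (hC s (hball hs) z hz) (norm_nonneg _)
    · rw [hkρ z (not_le.1 hz), zero_smul, norm_zero, norm_zero, zero_mul]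
  · exact Eventually.of_forall fun z s hs => (hd s (hballW hs) (y - z)).const_smul (k z)

end Near

/-! ### Parametric integrals in time, II: decaying bilinear kernels against decaying fields -/

section Far

variable {W : Set ℝ}

/-- `(1 + |z|)⁻⁴` is integrable on `ℝ³`. [folklore] -/
theorem integrable_inv_one_add_norm_pow_four :
    Integrable fun y : EuclideanSpace ℝ (Fin 3) => ((1 + ‖y‖) ^ 4)⁻¹ := by
  have h := integrable_one_add_norm (E := EuclideanSpace ℝ (Fin 3)) (μ := volume) (r := 4) (by simp; norm_num)
  refine h.congr (Eventually.of_forall fun y => ?_)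
  have h0 : 0 < 1 + ‖y‖ := by positivity
  show (1 + ‖y‖) ^ (-(4 : ℝ)) = ((1 + ‖y‖) ^ 4)⁻¹
  rw [Real.rpow_neg h0.le, show (4 : ℝ) = ((4 : ℕ) : ℝ) by norm_num, Real.rpow_natCast]

/-- **The far-field weight inequality**:
`(1+|y|) (1+|y−η|)⁻³ (1+|η|)⁻² ≤ 2((1+|y−η|)⁻⁴ + (1+|η|)⁻⁴)` (`1+|y| ≤ a + b` with `a = 1+|y−η|`,
`b = 1+|η|`, and `a⁻²b⁻², a⁻³b⁻¹ ≤ a⁻⁴ + b⁻⁴`): the convolution of `(1+|·|)⁻³` with `(1+|·|)⁻²` decays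
like `(1+|y|)⁻¹`. [folklore] -/
theorem weight_kernel_le (y η : EuclideanSpace ℝ (Fin 3)) :
    (1 + ‖y‖) * (((1 + ‖y - η‖) ^ 3)⁻¹ * ((1 + ‖η‖) ^ 2)⁻¹) ≤
      2 * (((1 + ‖y - η‖) ^ 4)⁻¹ + ((1 + ‖η‖) ^ 4)⁻¹) := by
  set a : ℝ := 1 + ‖y - η‖ with ha
  set b : ℝ := 1 + ‖η‖ with hb
  have ha0 : 0 < a := by rw [ha]; positivity
  have hb0 : 0 < b := by rw [hb]; positivity
  have hy : 1 + ‖y‖ ≤ a + b := by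
    have := norm_le_norm_add_norm_sub' y η
    have := norm_sub_rev y η
    rw [ha, hb]; linarith [norm_nonneg η]
  have h1 : (1 + ‖y‖) * ((a ^ 3)⁻¹ * (b ^ 2)⁻¹) ≤ (a ^ 2 * b ^ 2)⁻¹ + (a ^ 3 * b)⁻¹ := by
    calc (1 + ‖y‖) * ((a ^ 3)⁻¹ * (b ^ 2)⁻¹) ≤ (a + b) * ((a ^ 3)⁻¹ * (b ^ 2)⁻¹) :=
          mul_le_mul_of_nonneg_right hy (by positivity)
      _ = (a ^ 2 * b ^ 2)⁻¹ + (a ^ 3 * b)⁻¹ := by field_simp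
  have h2 : (a ^ 2 * b ^ 2)⁻¹ ≤ (a ^ 4)⁻¹ + (b ^ 4)⁻¹ := by
    rw [← one_div, ← one_div, ← one_div, div_add_div _ _ (by positivity) (by positivity),
      div_le_div_iff₀ (by positivity) (by positivity)]
    nlinarith [sq_nonneg (a ^ 2 - b ^ 2), pow_pos ha0 2, pow_pos hb0 2, pow_pos ha0 4, pow_pos hb0 4,
      mul_pos (pow_pos ha0 2) (pow_pos hb0 2)]
  have h3 : (a ^ 3 * b)⁻¹ ≤ (a ^ 4)⁻¹ + (b ^ 4)⁻¹ := by
    rw [← one_div, ← one_div, ← one_div, div_add_div _ _ (by positivity) (by positivity),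
      div_le_div_iff₀ (by positivity) (by positivity)]
    have key : a * b ^ 3 ≤ a ^ 4 + b ^ 4 := by
      rcases le_total a b with hab | hab
      · calc a * b ^ 3 ≤ b * b ^ 3 := mul_le_mul_of_nonneg_right hab (by positivity)
          _ = b ^ 4 := by ring
          _ ≤ a ^ 4 + b ^ 4 := le_add_of_nonneg_left (by positivity)
      · calc a * b ^ 3 ≤ a * a ^ 3 :=
            mul_le_mul_of_nonneg_left (pow_le_pow_left₀ hb0.le hab 3) ha0.le
          _ = a ^ 4 := by ring
          _ ≤ a ^ 4 + b ^ 4 := le_add_of_nonneg_right (by positivity)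
    nlinarith [key, pow_pos ha0 3, pow_pos hb0 4, pow_pos ha0 4, mul_pos (pow_pos ha0 3) hb0]
  linarith

/-- The far-field dominator: for a kernel with `‖K z‖ ≤ M/(1+|z|)³` and fields with `‖u η‖, ‖w η‖ ≤ A/(1+|η|)`,
`‖K(y − η)‖ ‖u η‖ ‖w η‖ ≤ M A² (1+|y|)⁻¹ · 2((1+|y−η|)⁻⁴ + (1+|η|)⁻⁴)`. [folklore] -/
theorem far_dominator_le {F : Type*} [NormedAddCommGroup F] {K : EuclideanSpace ℝ (Fin 3) → F} {M : ℝ}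
    (hK : HasDecay 3 M K) {A : ℝ} (hA : 0 ≤ A) {a c : ℝ} (y η : EuclideanSpace ℝ (Fin 3))
    (ha : 0 ≤ a) (hc : 0 ≤ c) (hab : a ≤ A / (1 + ‖η‖)) (hcb : c ≤ A / (1 + ‖η‖)) :
    ‖K (y - η)‖ * a * c ≤
      M * A ^ 2 * (1 + ‖y‖)⁻¹ * (2 * (((1 + ‖y - η‖) ^ 4)⁻¹ + ((1 + ‖η‖) ^ 4)⁻¹)) := by
  have hM := hK.nonneg
  have hy0 : 0 < 1 + ‖y‖ := by positivity
  have hη0 : 0 < 1 + ‖η‖ := by positivity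
  have hw := weight_kernel_le y η
  calc ‖K (y - η)‖ * a * c ≤ M * ((1 + ‖y - η‖) ^ 3)⁻¹ * (A / (1 + ‖η‖)) * (A / (1 + ‖η‖)) := by
        have := hK (y - η)
        gcongr
    _ = M * A ^ 2 * (1 + ‖y‖)⁻¹ * ((1 + ‖y‖) * (((1 + ‖y - η‖) ^ 3)⁻¹ * ((1 + ‖η‖) ^ 2)⁻¹)) := by
        field_simp
    _ ≤ M * A ^ 2 * (1 + ‖y‖)⁻¹ * (2 * (((1 + ‖y - η‖) ^ 4)⁻¹ + ((1 + ‖η‖) ^ 4)⁻¹)) :=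
        mul_le_mul_of_nonneg_left hw (by positivity)

/-- The far-field dominator is integrable, with integral `4 I₄ M A² (1+|y|)⁻¹`, `I₄ = ∫(1+|η|)⁻⁴`. [folklore] -/
theorem integral_far_dominator (M A : ℝ) (y : EuclideanSpace ℝ (Fin 3)) :
    Integrable (fun η : EuclideanSpace ℝ (Fin 3) =>
      M * A ^ 2 * (1 + ‖y‖)⁻¹ * (2 * (((1 + ‖y - η‖) ^ 4)⁻¹ + ((1 + ‖η‖) ^ 4)⁻¹))) ∧
    ∫ η : EuclideanSpace ℝ (Fin 3), M * A ^ 2 * (1 + ‖y‖)⁻¹ * (2 * (((1 + ‖y - η‖) ^ 4)⁻¹ + ((1 + ‖η‖) ^ 4)⁻¹)) =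
      M * A ^ 2 * (1 + ‖y‖)⁻¹ * (4 * ∫ η : EuclideanSpace ℝ (Fin 3), ((1 + ‖η‖) ^ 4)⁻¹) := by
  have hI := integrable_inv_one_add_norm_pow_four
  have hIy : Integrable fun η : EuclideanSpace ℝ (Fin 3) => ((1 + ‖y - η‖) ^ 4)⁻¹ :=
    hI.comp_sub_left y
  have hsum := (hIy.add hI).const_mul 2
  refine ⟨hsum.const_mul _, ?_⟩
  rw [integral_const_mul, integral_const_mul, integral_add hIy hI]
  have : ∫ η : EuclideanSpace ℝ (Fin 3), ((1 + ‖y - η‖) ^ 4)⁻¹ = ∫ η : EuclideanSpace ℝ (Fin 3), ((1 + ‖η‖) ^ 4)⁻¹ :=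
    integral_sub_left_eq_self (fun η : EuclideanSpace ℝ (Fin 3) => ((1 + ‖η‖) ^ 4)⁻¹) volume y
  rw [this]
  ring

variable {K : EuclideanSpace ℝ (Fin 3) → (EuclideanSpace ℝ (Fin 3)) →L[ℝ] (EuclideanSpace ℝ (Fin 3)) →L[ℝ] ℝ}
  {M A : ℝ}

/-- **Decay in `y` of the far bilinear integral**: `|∫ K(y − η)(u η)(w η) dη| ≤ 4 I₄ M A²/(1+|y|)` for a kernel
`‖K z‖ ≤ M/(1+|z|)³` and continuous fields `‖u η‖, ‖w η‖ ≤ A/(1+|η|)`. [folklore] -/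
theorem norm_far_integral_le (hK : HasDecay 3 M K) (hA : 0 ≤ A)
    {u w : EuclideanSpace ℝ (Fin 3) → EuclideanSpace ℝ (Fin 3)}
    (hub : ∀ η, ‖u η‖ ≤ A / (1 + ‖η‖)) (hwb : ∀ η, ‖w η‖ ≤ A / (1 + ‖η‖)) (y : EuclideanSpace ℝ (Fin 3)) :
    ‖∫ η, K (y - η) (u η) (w η)‖ ≤
      M * A ^ 2 * (1 + ‖y‖)⁻¹ * (4 * ∫ η : EuclideanSpace ℝ (Fin 3), ((1 + ‖η‖) ^ 4)⁻¹) := by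
  obtain ⟨hgi, hgint⟩ := integral_far_dominator M A y
  rw [← hgint]
  refine norm_integral_le_of_norm_le hgi (Eventually.of_forall fun η => ?_)
  calc ‖K (y - η) (u η) (w η)‖ ≤ ‖K (y - η) (u η)‖ * ‖w η‖ := ContinuousLinearMap.le_opNorm _ _
    _ ≤ ‖K (y - η)‖ * ‖u η‖ * ‖w η‖ := by gcongr; exact ContinuousLinearMap.le_opNorm _ _
    _ ≤ _ := far_dominator_le hK hA y η (norm_nonneg _) (norm_nonneg _) (hub η) (hwb η)

/-- **Continuity in time of the far bilinear integral** `t ↦ ∫ K(y − η)(u t η)(w t η) dη` for jointly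
continuous fields with `‖u t η‖, ‖w t η‖ ≤ A/(1+|η|)` on `W`. [folklore] -/
theorem continuousOn_far_integral (hKc : Continuous K) (hK : HasDecay 3 M K) (hA : 0 ≤ A)
    {u w : ℝ → EuclideanSpace ℝ (Fin 3) → EuclideanSpace ℝ (Fin 3)}
    (hu : ContinuousOn (uncurry u) (W ×ˢ univ)) (hw : ContinuousOn (uncurry w) (W ×ˢ univ))
    (hub : ∀ t ∈ W, ∀ η, ‖u t η‖ ≤ A / (1 + ‖η‖)) (hwb : ∀ t ∈ W, ∀ η, ‖w t η‖ ≤ A / (1 + ‖η‖))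
    (y : EuclideanSpace ℝ (Fin 3)) :
    ContinuousOn (fun t => ∫ η, K (y - η) (u t η) (w t η)) W := by
  obtain ⟨hgi, -⟩ := integral_far_dominator M A y
  have hKy : Continuous fun η => K (y - η) := hKc.comp (continuous_const.sub continuous_id)
  refine continuousOn_of_dominated (fun t ht => ?_) (fun t ht => Eventually.of_forall fun η => ?_) hgi ?_
  · exact ((hKy.clm_apply (continuous_slice_of_continuousOn_prod hu ht)).clm_apply
      (continuous_slice_of_continuousOn_prod hw ht)).aestronglyMeasurable
  · calc ‖K (y - η) (u t η) (w t η)‖ ≤ ‖K (y - η) (u t η)‖ * ‖w t η‖ := ContinuousLinearMap.le_opNorm _ _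
      _ ≤ ‖K (y - η)‖ * ‖u t η‖ * ‖w t η‖ := by gcongr; exact ContinuousLinearMap.le_opNorm _ _
      _ ≤ _ := far_dominator_le hK hA y η (norm_nonneg _) (norm_nonneg _) (hub t ht η) (hwb t ht η)
  · refine Eventually.of_forall fun η => ?_
    exact (continuousOn_const.clm_apply (continuousOn_timeLine_of_continuousOn_prod hu η)).clm_apply
      (continuousOn_timeLine_of_continuousOn_prod hw η)

/-- **Differentiation in time of the far bilinear integral**: if moreover `∂ₜu = u₁`, `∂ₜw = w₁` on `W` with
`u₁, w₁` jointly continuous and `‖u₁ t η‖, ‖w₁ t η‖ ≤ A/(1+|η|)`, then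
`∂ₜ ∫ K(y − η)(u t η)(w t η) dη = ∫ K(y − η)(u₁ t η)(w t η) dη + ∫ K(y − η)(u t η)(w₁ t η) dη`. [folklore] -/
theorem hasDerivAt_far_integral (hW : IsOpen W) (hKc : Continuous K) (hK : HasDecay 3 M K) (hA : 0 ≤ A)
    {u w u₁ w₁ : ℝ → EuclideanSpace ℝ (Fin 3) → EuclideanSpace ℝ (Fin 3)}
    (hu : ContinuousOn (uncurry u) (W ×ˢ univ)) (hw : ContinuousOn (uncurry w) (W ×ˢ univ))
    (hu₁ : ContinuousOn (uncurry u₁) (W ×ˢ univ)) (hw₁ : ContinuousOn (uncurry w₁) (W ×ˢ univ))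
    (hdu : ∀ t ∈ W, ∀ η, HasDerivAt (fun s => u s η) (u₁ t η) t)
    (hdw : ∀ t ∈ W, ∀ η, HasDerivAt (fun s => w s η) (w₁ t η) t)
    (hub : ∀ t ∈ W, ∀ η, ‖u t η‖ ≤ A / (1 + ‖η‖)) (hwb : ∀ t ∈ W, ∀ η, ‖w t η‖ ≤ A / (1 + ‖η‖))
    (hu₁b : ∀ t ∈ W, ∀ η, ‖u₁ t η‖ ≤ A / (1 + ‖η‖)) (hw₁b : ∀ t ∈ W, ∀ η, ‖w₁ t η‖ ≤ A / (1 + ‖η‖))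
    (y : EuclideanSpace ℝ (Fin 3)) {t : ℝ} (ht : t ∈ W) :
    HasDerivAt (fun s => ∫ η, K (y - η) (u s η) (w s η))
      ((∫ η, K (y - η) (u₁ t η) (w t η)) + ∫ η, K (y - η) (u t η) (w₁ t η)) t := by
  obtain ⟨hgi, -⟩ := integral_far_dominator M A y
  have hKy : Continuous fun η => K (y - η) := hKc.comp (continuous_const.sub continuous_id)
  have hmeas : ∀ {u' w' : ℝ → EuclideanSpace ℝ (Fin 3) → EuclideanSpace ℝ (Fin 3)},
      ContinuousOn (uncurry u') (W ×ˢ univ) → ContinuousOn (uncurry w') (W ×ˢ univ) → ∀ s ∈ W,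
      AEStronglyMeasurable (fun η => K (y - η) (u' s η) (w' s η)) volume := fun hu' hw' s hs =>
    ((hKy.clm_apply (continuous_slice_of_continuousOn_prod hu' hs)).clm_apply
      (continuous_slice_of_continuousOn_prod hw' hs)).aestronglyMeasurable
  have hbd : ∀ {u' w' : ℝ → EuclideanSpace ℝ (Fin 3) → EuclideanSpace ℝ (Fin 3)},
      (∀ t ∈ W, ∀ η, ‖u' t η‖ ≤ A / (1 + ‖η‖)) → (∀ t ∈ W, ∀ η, ‖w' t η‖ ≤ A / (1 + ‖η‖)) →
      ∀ s ∈ W, ∀ η, ‖K (y - η) (u' s η) (w' s η)‖ ≤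
        M * A ^ 2 * (1 + ‖y‖)⁻¹ * (2 * (((1 + ‖y - η‖) ^ 4)⁻¹ + ((1 + ‖η‖) ^ 4)⁻¹)) := by
    intro u' w' hu'b hw'b s hs η
    calc ‖K (y - η) (u' s η) (w' s η)‖ ≤ ‖K (y - η) (u' s η)‖ * ‖w' s η‖ := ContinuousLinearMap.le_opNorm _ _
      _ ≤ ‖K (y - η)‖ * ‖u' s η‖ * ‖w' s η‖ := by gcongr; exact ContinuousLinearMap.le_opNorm _ _
      _ ≤ _ := far_dominator_le hK hA y η (norm_nonneg _) (norm_nonneg _) (hu'b s hs η) (hw'b s hs η)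
  have hint : ∀ {u' w' : ℝ → EuclideanSpace ℝ (Fin 3) → EuclideanSpace ℝ (Fin 3)},
      ContinuousOn (uncurry u') (W ×ˢ univ) → ContinuousOn (uncurry w') (W ×ˢ univ) →
      (∀ t ∈ W, ∀ η, ‖u' t η‖ ≤ A / (1 + ‖η‖)) → (∀ t ∈ W, ∀ η, ‖w' t η‖ ≤ A / (1 + ‖η‖)) →
      ∀ s ∈ W, Integrable (fun η => K (y - η) (u' s η) (w' s η)) := fun hu' hw' hu'b hw'b s hs =>
    Integrable.mono' hgi (hmeas hu' hw' s hs) (Eventually.of_forall (hbd hu'b hw'b s hs))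
  have key := hasDerivAt_integral_of_dominated_loc_of_deriv_le
    (F := fun s η => K (y - η) (u s η) (w s η))
    (F' := fun s η => K (y - η) (u₁ s η) (w s η) + K (y - η) (u s η) (w₁ s η))
    (bound := fun η => 2 * (M * A ^ 2 * (1 + ‖y‖)⁻¹ * (2 * (((1 + ‖y - η‖) ^ 4)⁻¹ + ((1 + ‖η‖) ^ 4)⁻¹))))
    (hW.mem_nhds ht) ?_ (hint hu hw hub hwb t ht) ?_ ?_ (hgi.const_mul 2) ?_
  · have e : (∫ η, K (y - η) (u₁ t η) (w t η) + K (y - η) (u t η) (w₁ t η)) =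
        (∫ η, K (y - η) (u₁ t η) (w t η)) + ∫ η, K (y - η) (u t η) (w₁ t η) :=
      integral_add (hint hu₁ hw hu₁b hwb t ht) (hint hu hw₁ hub hw₁b t ht)
    rw [← e]
    exact key.2
  · filter_upwards [hW.mem_nhds ht] with s hs using hmeas hu hw s hs
  · exact (hmeas hu₁ hw t ht).add (hmeas hu hw₁ t ht)
  · refine Eventually.of_forall fun η s hs => (norm_add_le _ _).trans ?_
    have := hbd hu₁b hwb s hs η
    have := hbd hub hw₁b s hs η
    linarith
  · refine Eventually.of_forall fun η s hs => ?_
    have h1 : HasDerivAt (fun σ => K (y - η) (u σ η)) (K (y - η) (u₁ s η)) s :=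
      (K (y - η)).hasFDerivAt.comp_hasDerivAt s (hdu s hs η)
    exact h1.clm_apply (hdw s hs η)

end Far


/-- **Registered sub-goal `stub_apexRegFarWeight` of `stub_apexRegularity`**: the far-field weight inequality
(`weight_kernel_le`). [folklore] -/
theorem stub_apexRegFarWeight :
    ∀ y η : EuclideanSpace ℝ (Fin 3), (1 + ‖y‖) * (((1 + ‖y - η‖) ^ 3)⁻¹ * ((1 + ‖η‖) ^ 2)⁻¹) ≤ 2 * (((1 +
      ‖y - η‖) ^ 4)⁻¹ + ((1 + ‖η‖) ^ 4)⁻¹) :=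
  fun y η => weight_kernel_le y η

end Summit.NavierStokesRegularity.NavierStokesRegularity.Theorems.RellichScarScarRigidity

end
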